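import Literature.AlgebraicGeometry.Resolution.FlatLocalRegularAscent
import Literature.AlgebraicGeometry.Resolution.NagataCriterion
import Literature.AlgebraicGeometry.Resolution.ResolutionOfSingularities
import Mathlib.AlgebraicGeometry.Pullbacks
import Mathlib.AlgebraicGeometry.PullbackCarrier
import Mathlib.AlgebraicGeometry.Morphisms.UniversallyClosed
import Mathlib.AlgebraicGeometry.Morphisms.FiniteType
import Mathlib.AlgebraicGeometry.Morphisms.RingHomProperties
import Mathlib.RingTheory.FiniteType
import HarnessLib

/-!
# The base change of a proper regular scheme to a "completion-like" local algebra is regular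

Topic: `Literature/AlgebraicGeometry/Resolution`. Scheme-theoretic core of Grothendieck's
theorem "resolution of singularities forces quasi-excellence" (EGA IV₂ (7.9.5), rendered by
Temkin 2008, §1; named fact `Grothendieck1965_7_9_5`,
`Literature/Barriers/ResolutionOfSingularities/QuasiExcellenceNecessary.lean`), in the spirit
of EGA IV₂ (7.9.3): let `D` be a ring, `P` a prime, and `E` a local `D`-algebra which is flat,
with `𝔪_E = P E`, `𝔪_E ∩ D ⊆ P` and residue field generated by `D_P` (the completion
`E = (D_P)^` of the Noetherian local ring `D_P` is the case of interest). If `q : Y → Spec D` is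
universally closed and locally of finite type and `Y` is a regular scheme, then
`Z = Y ×_{Spec D} Spec E` is a regular scheme (`isRegular_pullback_of_closedFibre`). Proof: every
point `z` of `Z` specialises to a point `z₀` over the closed point of `Spec E` (`Z → Spec E`
is closed); at `z₀` the local ring is regular by the local algebra of
`FlatLocalRegularAscent.lean` (in an affine chart `Spec (Γ(Y, W) ⊗_D E)` of `Z`), and
`𝒪_{Z,z}` is a localisation of `𝒪_{Z,z₀}` (Serre, Matsumura Thm. 19.3). Everything is PROVED.

* `specTensorChart E q i hi` — for an open immersion `i : Spec B → Y`, `i ≫ q = Spec (D → B)`: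
  the open
  immersion `Spec (B ⊗_D E) → Y ×_{Spec D} Spec E` (pullback pasting and Mathlib's
  `pullbackSpecIso`), with its range and its two projections.
* `isRegularLocalRing_stalk_Spec_iff` — the local ring of `Spec R` at `𝔭` is regular iff
  `R_𝔭` is.
* `isRegular_pullback_of_closedFibre` — the theorem above.

## Sources

* A. Grothendieck, EGA IV₂, (7.9.3), (7.9.5). [EGAIV2]
* H. Matsumura, *Commutative Ring Theory*, CUP 1986, Thm. 23.7, Thm. 19.3. [Matsumura1987]
-/

noncomputable section

open CategoryTheory CategoryTheory.Limits AlgebraicGeometry TopologicalSpace TensorProduct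
  IsLocalRing

namespace Literature.AlgebraicGeometry.Resolution

universe u

/-! ## Local rings of `Spec R` -/

/-- The local ring of `Spec R` at a prime `𝔭` is a regular local ring iff `R_𝔭` is.
[folklore] -/
theorem isRegularLocalRing_stalk_Spec_iff (R : Type u) [CommRing R] (p : PrimeSpectrum R) :
    IsRegularLocalRing ((Spec (.of R)).presheaf.stalk p) ↔
      IsRegularLocalRing (Localization.AtPrime p.asIdeal) := by
  let e : (Spec.structureSheaf R).presheaf.stalk p ≃ₐ[R] Localization.AtPrime p.asIdeal :=
    IsLocalization.algEquiv p.asIdeal.primeCompl _ _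
  change IsRegularLocalRing ((Spec.structureSheaf R).presheaf.stalk p) ↔ _
  exact ⟨fun _ => IsRegularLocalRing.of_ringEquiv e.toRingEquiv,
    fun _ => IsRegularLocalRing.of_ringEquiv e.toRingEquiv.symm⟩

/-- Along an open immersion, the local ring at a point is regular iff the local ring at its
image is. [folklore] -/
theorem isRegularLocalRing_stalk_iff_of_isOpenImmersion {U X : Scheme.{u}} (j : U ⟶ X)
    [IsOpenImmersion j] (x : U) :
    IsRegularLocalRing (X.presheaf.stalk (j x)) ↔ IsRegularLocalRing (U.presheaf.stalk x) :=
  ⟨fun _ => IsRegularLocalRing.of_ringEquiv (asIso (j.stalkMap x)).commRingCatIsoToRingEquiv,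
    fun _ => IsRegularLocalRing.of_ringEquiv (asIso (j.stalkMap x)).commRingCatIsoToRingEquiv.symm⟩

/-! ## Affine charts of `Y ×_{Spec D} Spec E` -/

section Chart

/-- The morphism `Spec E → Spec D` of a `D`-algebra `E`. [folklore] -/
abbrev specOfAlgebra (D E : Type u) [CommRing D] [CommRing E] [Algebra D E] :
    Spec (.of E) ⟶ Spec (.of D) :=
  Spec.map (CommRingCat.ofHom (algebraMap D E))

/-- Precomposing with a surjective morphism does not change the range. [folklore] -/
theorem range_comp_of_surjective {X₁ X₂ X₃ : Scheme.{u}} (e : X₁ ⟶ X₂) (g : X₂ ⟶ X₃)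
    (he : Function.Surjective e) : Set.range (e ≫ g) = Set.range g := by
  ext z
  constructor
  · rintro ⟨x, rfl⟩
    exact ⟨e x, (Scheme.Hom.comp_apply e g x).symm⟩
  · rintro ⟨y, rfl⟩
    obtain ⟨x, rfl⟩ := he y
    exact ⟨x, Scheme.Hom.comp_apply e g x⟩

variable {D : Type u} (E : Type u) [CommRing D] [CommRing E] [Algebra D E] {Y : Scheme.{u}}
  (q : Y ⟶ Spec (.of D)) {B : Type u} [CommRing B] [Algebra D B] (i : Spec (.of B) ⟶ Y)
  (hi : i ≫ q = Spec.map (CommRingCat.ofHom (algebraMap D B)))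

/-- **The affine chart `Spec (B ⊗_D E) → Y ×_{Spec D} Spec E`** over an affine open
`i : Spec B ↪ Y` with `i ≫ q = Spec (D → B)`: the composite of Mathlib's
`Spec (B ⊗_D E) ≅ Spec B ×_{Spec D} Spec E`, of `Spec B ×_{Spec D} Spec E ≅ (Spec B) ×_Y
(Y ×_{Spec D} Spec E)` (pullback pasting) and of the second projection of the latter.
[folklore] -/
def specTensorChart : Spec (.of (B ⊗[D] E)) ⟶ pullback q (specOfAlgebra D E) :=
  (pullbackSpecIso D B E).inv ≫ (pullback.congrHom hi rfl).inv ≫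
    (pullbackRightPullbackFstIso q (specOfAlgebra D E) i).inv ≫
      pullback.snd i (pullback.fst q (specOfAlgebra D E))

/-- The chart is an open immersion (a base change of `i`). [folklore] -/
instance specTensorChart_isOpenImmersion [IsOpenImmersion i] :
    IsOpenImmersion (specTensorChart E q i hi) := by
  unfold specTensorChart
  infer_instance

/-- The chart followed by the first projection is `Spec (B ⊗_D E) → Spec B ↪ Y`. [folklore] -/
@[reassoc]
theorem specTensorChart_fst : specTensorChart E q i hi ≫ pullback.fst q (specOfAlgebra D E) =
    Spec.map (CommRingCat.ofHom (Algebra.TensorProduct.includeLeftRingHom (R := D) (A := B)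
      (B := E))) ≫ i := by
  unfold specTensorChart
  simp only [Category.assoc]
  rw [← pullback.condition, pullbackRightPullbackFstIso_inv_fst_assoc, pullback.congrHom_inv,
    pullback.lift_fst_assoc, Category.comp_id, pullbackSpecIso_inv_fst_assoc]

/-- The chart followed by the second projection is `Spec` of `E → B ⊗_D E`. [folklore] -/
@[reassoc]
theorem specTensorChart_snd : specTensorChart E q i hi ≫ pullback.snd q (specOfAlgebra D E) =
    Spec.map (CommRingCat.ofHom (RingHomClass.toRingHom
      (Algebra.TensorProduct.includeRight (R := D) (A := B) (B := E)))) := by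
  unfold specTensorChart
  simp only [Category.assoc]
  rw [pullbackRightPullbackFstIso_inv_snd_snd, pullback.congrHom_inv, pullback.lift_snd,
    Category.comp_id, pullbackSpecIso_inv_snd]

/-- The range of the chart is the preimage of the affine open `i(Spec B)`. [folklore] -/
theorem range_specTensorChart [IsOpenImmersion i] : Set.range (specTensorChart E q i hi) =
    pullback.fst q (specOfAlgebra D E) ⁻¹' Set.range i := by
  unfold specTensorChart
  rw [range_comp_of_surjective _ _ (pullbackSpecIso D B E).inv.surjective,
    range_comp_of_surjective _ _ (pullback.congrHom hi rfl).inv.surjective,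
    range_comp_of_surjective _ _
      (pullbackRightPullbackFstIso q (specOfAlgebra D E) i).inv.surjective]
  exact Scheme.Pullback.range_snd _ _

end Chart

/-! ## Regularity of `Y ×_{Spec D} Spec E` -/

section Regular

variable {D : Type u} (E : Type u) [CommRing D] [CommRing E] [Algebra D E] [IsNoetherianRing E]

/-- `B ⊗_D E` is Noetherian for `B` of finite type over `D` and `E` Noetherian. [folklore] -/
theorem isNoetherianRing_tensor_of_finiteType (B : Type u) [CommRing B] [Algebra D B]
    [Algebra.FiniteType D B] : IsNoetherianRing (B ⊗[D] E) := by
  haveI : Algebra.FiniteType E (E ⊗[D] B) := inferInstance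
  haveI : IsNoetherianRing (E ⊗[D] B) := Algebra.FiniteType.isNoetherianRing E _
  exact isNoetherianRing_of_ringEquiv (E ⊗[D] B) (Algebra.TensorProduct.comm D E B).toRingEquiv

variable [IsLocalRing E] [Module.Flat D E] (P : Ideal D) [P.IsPrime]
  (hres : ∀ e : E, ∃ d : D, ∃ u ∉ P, algebraMap D E u * e - algebraMap D E d ∈ maximalIdeal E)
  (hmax : maximalIdeal E = P.map (algebraMap D E))
  (hcomap : (maximalIdeal E).comap (algebraMap D E) ≤ P)

include hres hmax hcomap in
/-- **The base change `Y ×_{Spec D} Spec E` of a universally closed, locally finite type,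
regular `D`-scheme `Y` is a regular scheme**, for `E` a Noetherian local flat `D`-algebra with
`𝔪_E = P E`, `𝔪_E ∩ D ⊆ P` and residue field generated by `D_P` — e.g. `E = (D_P)^` for `D`
Noetherian (EGA IV₂ (7.9.3)/(7.9.5): "`Y ⊗_A Â` est régulier"). Every point `z` of the base
change specialises to a point `z₀` over the closed point of `Spec E` (`Z → Spec E` is a closed
map); in an affine chart `Spec (Γ(Y, W) ⊗_D E) ∋ z₀` the local ring at `z₀` is regular by
`isRegularLocalRing_localization_tensor_of_closedFibre` (Matsumura 23.7 (ii)), and the local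
ring at `z` is a localisation of it (Matsumura 19.3). [cite: EGAIV2, (7.9.3) and (7.9.5)] -/
theorem isRegular_pullback_of_closedFibre {Y : Scheme.{u}} (q : Y ⟶ Spec (.of D))
    [UniversallyClosed q] [LocallyOfFiniteType q] (hY : Scheme.IsRegular Y) :
    Scheme.IsRegular (pullback q (specOfAlgebra D E)) := by
  intro z
  set p₁ := pullback.fst q (specOfAlgebra D E) with hp₁
  set p₂ := pullback.snd q (specOfAlgebra D E) with hp₂
  -- Step 1: a specialisation `z₀` of `z` over the closed point of `Spec E`
  have hclosed : IsClosed (p₂ '' closure {z}) := p₂.isClosedMap _ isClosed_closure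
  have hmem : (closedPoint E : ↥(Spec (CommRingCat.of E))) ∈ p₂ '' closure {z} := by
    have hz : p₂ z ∈ p₂ '' closure {z} := ⟨z, subset_closure rfl, rfl⟩
    exact (specializes_closedPoint (R := E) (p₂ z)).mem_closed hclosed hz
  obtain ⟨z₀, hz₀, hz₀c⟩ := hmem
  have hspec : z ⤳ z₀ := specializes_iff_mem_closure.mpr hz₀
  -- Step 2: an affine chart around `z₀`
  obtain ⟨W, hW, hyW, -⟩ := exists_isAffineOpen_mem_and_subset (X := Y) (x := p₁ z₀) (U := ⊤)
    trivial
  let iW : Spec Γ(Y, W) ⟶ Y := hW.fromSpec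
  let φ : CommRingCat.of D ⟶ Γ(Y, W) := Spec.preimage (iW ≫ q)
  letI : Algebra D Γ(Y, W) := φ.hom.toAlgebra
  have hi : iW ≫ q = Spec.map (CommRingCat.ofHom (algebraMap D Γ(Y, W))) := by
    rw [RingHom.algebraMap_toAlgebra, CommRingCat.ofHom_hom, Spec.map_preimage]
  -- `Γ(Y, W)` is of finite type over `D`, so `Γ(Y, W) ⊗_D E` is Noetherian
  haveI : Algebra.FiniteType D Γ(Y, W) := by
    have h1 : LocallyOfFiniteType (Spec.map (CommRingCat.ofHom (algebraMap D Γ(Y, W)))) := by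
      rw [← hi]; infer_instance
    have h2 := (HasRingHomProperty.Spec_iff (P := @LocallyOfFiniteType)).mp h1
    exact RingHom.finiteType_algebraMap.mp h2
  haveI : IsNoetherianRing (Γ(Y, W) ⊗[D] E) := isNoetherianRing_tensor_of_finiteType E Γ(Y, W)
  let c := specTensorChart E q iW hi
  have hz₀range : z₀ ∈ Set.range c := by
    change z₀ ∈ Set.range (specTensorChart E q iW hi)
    rw [range_specTensorChart, Set.mem_preimage, IsAffineOpen.range_fromSpec]
    exact hyW
  obtain ⟨ζ₀, hζ₀⟩ := hz₀range
  -- `z` lies in the same chart and generises `ζ₀` there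
  have hzrange : z ∈ Set.range c :=
    hspec.mem_open c.isOpenEmbedding.isOpen_range ⟨ζ₀, hζ₀⟩
  obtain ⟨ζ, hζ⟩ := hzrange
  have hle : @LE.le (PrimeSpectrum _) _ ζ ζ₀ := by
    rw [PrimeSpectrum.le_iff_specializes]
    have h1 : c ζ ⤳ c ζ₀ := by rw [hζ, hζ₀]; exact hspec
    exact c.isOpenEmbedding.isInducing.specializes_iff.mp h1
  -- Step 3: the prime `ζ₀` lies over the closed point of `E`
  have hζ₀max : maximalIdeal E ≤ ζ₀.asIdeal.comap
      (Algebra.TensorProduct.includeRight (R := D) (A := Γ(Y, W)) (B := E)).toRingHom := by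
    have h1 : p₂ (c ζ₀) = closedPoint E := by rw [hζ₀]; exact hz₀c
    rw [← Scheme.Hom.comp_apply] at h1
    change (specTensorChart E q iW hi ≫ pullback.snd q (specOfAlgebra D E)) ζ₀ = closedPoint E at h1
    rw [specTensorChart_snd, Spec.map_apply] at h1
    have h2 := congrArg PrimeSpectrum.asIdeal h1
    rw [PrimeSpectrum.comap_asIdeal] at h2
    change Ideal.comap _ ζ₀.asIdeal = maximalIdeal E at h2
    exact h2.ge
  -- Step 4: `B_{ζ₀ ∩ B}` is regular, being a local ring of the regular scheme `Y`
  have hreg₀ : IsRegularLocalRing (Localization.AtPrime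
      (ζ₀.asIdeal.comap (algebraMap Γ(Y, W) (Γ(Y, W) ⊗[D] E)))) := by
    let η : PrimeSpectrum Γ(Y, W) := PrimeSpectrum.comap (algebraMap Γ(Y, W) (Γ(Y, W) ⊗[D] E)) ζ₀
    have hη : IsRegularLocalRing ((Spec Γ(Y, W)).presheaf.stalk η) :=
      (isRegularLocalRing_stalk_iff_of_isOpenImmersion iW η).mp (hY _)
    exact (isRegularLocalRing_stalk_Spec_iff Γ(Y, W) η).mp hη
  have hregζ₀ : IsRegularLocalRing (Localization.AtPrime ζ₀.asIdeal) :=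
    isRegularLocalRing_localization_tensor_of_closedFibre P hres hmax hcomap ζ₀.asIdeal hζ₀max
      hreg₀
  -- Step 5: generise to `ζ` and transport to `z`
  have hregζ : IsRegularLocalRing (Localization.AtPrime ζ.asIdeal) := by
    have := mem_regularLocus_of_le hle ((mem_regularLocus ζ₀).mpr hregζ₀)
    exact (mem_regularLocus ζ).mp this
  rw [← hζ]
  exact (isRegularLocalRing_stalk_iff_of_isOpenImmersion c ζ).mpr
    ((isRegularLocalRing_stalk_Spec_iff _ ζ).mpr hregζ)

end Regular

end Literature.AlgebraicGeometry.Resolution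

end
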